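import Summits.FinalStateConjecture.FinalStateConjecture.Theorems.PhaseMixingCaptureBulkKerrCaptureC2CentreGaugeAdmissible
import Literature.Geometry.Lorentzian.ChartSecondFundamentalForm
import HarnessLib

/-!
# Crux `PhaseMixingCapture.BulkKerrCaptureC2` (stmt-FinalStateConjecture-14985): one-parameter gauge families
# of a datum on an open `U ⊆ ℝ³` — slice diffeomorphisms, pulled-back components, non-triviality

Support file (sequel of `…CentreGaugeAdmissible.lean`, geometric half of the `ε`-ball membership of the gauge
orbit).  An **ambient gauge family** is a jointly smooth `Ψ : ℝ → ℝ³ → ℝ³` with `Ψ (-t) ∘ Ψ t = id`,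
`Ψ t = id` off a compact `S ⊆ U` and `Ψ 0 = id` (e.g. the flow of a vector field supported in `S`; the
concrete twist family is built in the sequel).  Everything below is stated for such a family through
hypotheses (no definitions):

* §1 `Ψ t` preserves `U` (`family_mem_iff`) and restricts to a homeomorphism `Φ t` of the slice `U`
  (`exists_sliceHomeomorph`) that is smooth with differentials `dΦ = DΨ t` (`contMDiff_of_repr'`,
  `OpensChart.mfderiv_apply_of_repr`), injective (`injective_mfderiv_of_repr`), and is the identity off the
  compact `K₀ = S ∩ U` of the slice (`isCompact_preimage_val`, `fix_of_repr`);
* §2 the components of the pulled-back datum `Φ^* K` in the chart: on `U`,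
  `h(Φ^* K)(y) = h(K)(Ψ t y) ∘ (DΨ_t(y) × DΨ_t(y))` (`hFun_comap_of_repr`, `kFun_comap_of_repr`), a smooth
  expression (`contDiff_bilinearCompSelf`); hence the component DIFFERENCES `h(Φ_t^* K) - h(K)`,
  `k(Φ_t^* K) - k(K)` are jointly smooth on `ℝ × ℝ³` (`contDiff_hFun_family`, `contDiff_kFun_family`: smooth
  formula on `ℝ × U`, zero on `ℝ × Sᶜ`), supported in `S` (`support_hFun_family_subset`), and vanish at
  `t = 0` (`comap_family_zero`) — exactly the hypotheses of `…SobolevFamilyLimit.eventually_dataWeightedSobolevEDist_lt`;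
* §3 **non-triviality by a shear**: if `Ψ t` fixes a point `u ∈ U` and its differential there is a
  non-trivial shear (`DΨ_t(u) v = v + c w`, `DΨ_t(u) w = w`, `w ≠ 0`, `c ≠ 0`), then `Φ_t^* K ≠ K` for ANY
  Riemannian datum `K` (`comap_ne_of_shear`: `(Φ^*h)_u(v,w) - h_u(v,w) = c·h_u(w,w) > 0`) — no formula for
  `K` is needed.

References: R. Bartnik, J. Isenberg, *The constraint equations* (2004), §2 (gauge action on data);
B. O'Neill, *Semi-Riemannian geometry* (1983), Ch. 3 (pull-back metrics).
-/

-- the doubled `FinalStateConjecture.FinalStateConjecture` path component trips dupNamespace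
set_option linter.dupNamespace false

noncomputable section

open Set Filter Function Topology TopologicalSpace
open scoped Manifold ContDiff Topology
open Literature.Geometry.Lorentzian

namespace Summit.FinalStateConjecture.FinalStateConjecture.Theorems.BulkKerrCaptureC2.Centre

/-! ## §1 Ambient gauge families and the slice diffeomorphisms they induce -/

section Ambient

variable {U : Opens E3} {Ψ : ℝ → E3 → E3} {S : Set E3}

/-- `Ψ (-t)` is also a right inverse of `Ψ t`. [folklore] -/
theorem family_apply_neg_apply (hinv : ∀ t x, Ψ (-t) (Ψ t x) = x) (t : ℝ) (x : E3) :
    Ψ t (Ψ (-t) x) = x := by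
  simpa using hinv (-t) x

/-- A gauge family maps its support set `S` into itself (it is a bijection fixing `Sᶜ`). [folklore] -/
theorem family_mapsTo (hinv : ∀ t x, Ψ (-t) (Ψ t x) = x) (hfix : ∀ t x, x ∉ S → Ψ t x = x) (t : ℝ)
    {x : E3} (hx : x ∈ S) : Ψ t x ∈ S := by
  by_contra h
  have h1 : Ψ (-t) (Ψ t x) = Ψ t x := hfix (-t) _ h
  rw [hinv] at h1
  exact h (h1 ▸ hx)

/-- **A gauge family preserves the open set `U ⊇ S`**: `Ψ t x ∈ U ↔ x ∈ U`. [folklore] -/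
theorem family_mem_iff (hinv : ∀ t x, Ψ (-t) (Ψ t x) = x) (hfix : ∀ t x, x ∉ S → Ψ t x = x)
    (hSU : S ⊆ (U : Set E3)) (t : ℝ) (x : E3) : Ψ t x ∈ (U : Set E3) ↔ x ∈ (U : Set E3) := by
  by_cases hx : x ∈ S
  · exact ⟨fun _ ↦ hSU hx, fun _ ↦ hSU (family_mapsTo hinv hfix t hx)⟩
  · rw [hfix t x hx]

/-- **The slice homeomorphisms of a gauge family**: each `Ψ t` restricts to a homeomorphism `Φ` of the
slice `U` represented by `Ψ t` (and `Φ⁻¹` by `Ψ (-t)`). [folklore] -/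
theorem exists_sliceHomeomorph (hcont : Continuous (uncurry Ψ)) (hinv : ∀ t x, Ψ (-t) (Ψ t x) = x)
    (hfix : ∀ t x, x ∉ S → Ψ t x = x) (hSU : S ⊆ (U : Set E3)) (t : ℝ) :
    ∃ Φ : U ≃ₜ U, (∀ y, (Φ y : E3) = Ψ t y) ∧ ∀ y, (Φ.symm y : E3) = Ψ (-t) y := by
  have hc : ∀ t, Continuous (Ψ t) := fun t ↦ hcont.comp (Continuous.prodMk_right t)
  exact ⟨{ toFun := fun y ↦ ⟨Ψ t y, (family_mem_iff hinv hfix hSU t y).2 y.2⟩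
           invFun := fun y ↦ ⟨Ψ (-t) y, (family_mem_iff hinv hfix hSU (-t) y).2 y.2⟩
           left_inv := fun y ↦ Subtype.ext (hinv t y)
           right_inv := fun y ↦ Subtype.ext (family_apply_neg_apply hinv t y)
           continuous_toFun := ((hc t).comp continuous_subtype_val).subtype_mk _
           continuous_invFun := ((hc (-t)).comp continuous_subtype_val).subtype_mk _ },
    fun _ ↦ rfl, fun _ ↦ rfl⟩

/-- The compact `K₀ = S ∩ U` of the slice (preimage of `S ⊆ U` under the inclusion) is compact.
[folklore] -/
theorem isCompact_preimage_val (hS : IsCompact S) (hSU : S ⊆ (U : Set E3)) :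
    IsCompact ((Subtype.val : U → E3) ⁻¹' S) := by
  haveI : CompactSpace S := isCompact_iff_compactSpace.1 hS
  have hc : Continuous fun x : S ↦ (⟨(x : E3), hSU x.2⟩ : U) :=
    continuous_subtype_val.subtype_mk _
  have hr : range (fun x : S ↦ (⟨(x : E3), hSU x.2⟩ : U)) = (Subtype.val : U → E3) ⁻¹' S := by
    ext y
    constructor
    · rintro ⟨x, rfl⟩
      exact x.2
    · intro hy
      exact ⟨⟨(y : E3), hy⟩, Subtype.ext rfl⟩
  rw [← hr]
  exact isCompact_range hc

variable {Φ : U → U} {t : ℝ}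

/-- A slice map represented by `Ψ t` is the identity off `K₀ = S ∩ U`. [folklore] -/
theorem fix_of_repr (hrepr : ∀ y, (Φ y : E3) = Ψ t y) (hfix : ∀ t x, x ∉ S → Ψ t x = x) (y : U)
    (hy : y ∉ (Subtype.val : U → E3) ⁻¹' S) : Φ y = y :=
  Subtype.ext ((hrepr y).trans (hfix t y hy))

/-- A slice map represented by a smooth ambient map is smooth, in the degree `∞ + 1` of pull-backs of
data. [folklore] -/
theorem contMDiff_of_repr' (hrepr : ∀ y, (Φ y : E3) = Ψ t y) (hs : ContDiff ℝ ∞ (Ψ t)) :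
    ContMDiff (𝓡 3) (𝓡 3) (∞ + 1) Φ := by
  have h1 : ContMDiff 𝓘(ℝ, E3) 𝓘(ℝ, E3) ∞ Φ := by
    refine (ContMDiff.subtypeVal_comp_iff U Φ).1 ?_
    have : (Subtype.val ∘ Φ) = Ψ t ∘ (Subtype.val : U → E3) := funext fun y ↦ hrepr y
    rw [this]
    exact hs.contMDiff.comp contMDiff_subtype_val
  exact h1.of_le (le_of_eq (by rfl))

/-- The differential of a slice map represented by `Ψ t` is `DΨ_t`, which is injective since
`Ψ (-t) ∘ Ψ t = id` (chain rule). [folklore] -/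
theorem injective_mfderiv_of_repr (hrepr : ∀ y, (Φ y : E3) = Ψ t y)
    (hd : ∀ t x, DifferentiableAt ℝ (Ψ t) x) (hinv : ∀ t x, Ψ (-t) (Ψ t x) = x) (u : U) :
    Injective (mfderiv (𝓡 3) (𝓡 3) Φ u) := by
  have hcomp : (fderiv ℝ (Ψ (-t)) (Ψ t u)).comp (fderiv ℝ (Ψ t) u) =
      ContinuousLinearMap.id ℝ E3 := by
    have h1 : HasFDerivAt (Ψ (-t) ∘ Ψ t) ((fderiv ℝ (Ψ (-t)) (Ψ t u)).comp (fderiv ℝ (Ψ t) u)) u :=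
      (hd (-t) (Ψ t u)).hasFDerivAt.comp (u : E3) (hd t u).hasFDerivAt
    have h2 : (Ψ (-t) ∘ Ψ t) = id := funext fun x ↦ hinv t x
    rw [h2] at h1
    exact h1.unique (hasFDerivAt_id (u : E3))
  intro v w hvw
  have hv : mfderiv (𝓡 3) (𝓡 3) Φ u v = fderiv ℝ (Ψ t) u v :=
    OpensChart.mfderiv_apply_of_repr hrepr (hd t u) v
  have hw : mfderiv (𝓡 3) (𝓡 3) Φ u w = fderiv ℝ (Ψ t) u w :=
    OpensChart.mfderiv_apply_of_repr hrepr (hd t u) w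
  have key : ∀ z : E3, fderiv ℝ (Ψ (-t)) (Ψ t u) (fderiv ℝ (Ψ t) u z) = z := fun z ↦ by
    simpa using congrArg (fun L : E3 →L[ℝ] E3 ↦ L z) hcomp
  rw [← key v, ← key w, ← hv, ← hw]
  exact congrArg _ hvw

end Ambient

/-! ## §2 Components of the pulled-back datum; joint smoothness of the component differences -/

section Components

variable {U : Opens E3}

/-- The map `(B, A) ↦ B ∘ (A × A)` (`bilinearComp`) on bilinear forms and linear maps of `ℝ³` is
smooth (it is polynomial: compositions and flips of continuous linear maps). [folklore] -/
theorem contDiff_bilinearCompSelf :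
    ContDiff ℝ ∞ fun p : (E3 →L[ℝ] E3 →L[ℝ] ℝ) × (E3 →L[ℝ] E3) ↦ p.1.bilinearComp p.2 p.2 := by
  have h1 : ContDiff ℝ ∞ fun p : (E3 →L[ℝ] E3 →L[ℝ] ℝ) × (E3 →L[ℝ] E3) ↦ (p.1).comp p.2 :=
    contDiff_fst.clm_comp contDiff_snd
  have h2 := h1.continuousLinearMap_comp (G := E3 →L[ℝ] E3 →L[ℝ] ℝ)
    (ContinuousLinearMap.flipₗᵢ ℝ E3 E3 ℝ : _ →L[ℝ] _)
  have h3 := h2.clm_comp (contDiff_snd (n := ∞) (E := E3 →L[ℝ] E3 →L[ℝ] ℝ) (F := E3 →L[ℝ] E3))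
  have h4 := h3.continuousLinearMap_comp (G := E3 →L[ℝ] E3 →L[ℝ] ℝ)
    (ContinuousLinearMap.flipₗᵢ ℝ E3 E3 ℝ : _ →L[ℝ] _)
  exact h4

variable (K : InitialDataSet 𝓘(ℝ, E3) U) {Ψ : ℝ → E3 → E3} {S : Set E3}

/-- **The metric components of the pulled-back datum in the chart**: for a slice map `Φ` represented
by the ambient `Ψ t`, at `y ∈ U`, `h(Φ^* K)(y) = h(K)(Ψ t y) ∘ (DΨ_t(y) × DΨ_t(y))`.
Bartnik–Isenberg 2004, §2. [folklore] -/
theorem hFun_comap_of_repr {Φ : U → U} {t : ℝ} (hrepr : ∀ y, (Φ y : E3) = Ψ t y)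
    (hΦ : ContMDiff (𝓡 3) (𝓡 3) (∞ + 1) Φ) (hΦ' : ∀ u, Injective (mfderiv (𝓡 3) (𝓡 3) Φ u))
    (hd : ∀ t x, DifferentiableAt ℝ (Ψ t) x) {y : E3} (hy : y ∈ (U : Set E3)) :
    (K.comap Φ hΦ hΦ').hFun y =
      (K.hFun (Ψ t y)).bilinearComp (fderiv ℝ (Ψ t) y) (fderiv ℝ (Ψ t) y) := by
  have hy' : Ψ t y ∈ (U : Set E3) := by
    rw [← hrepr ⟨y, hy⟩]
    exact (Φ ⟨y, hy⟩).2
  have hpt : Φ ⟨y, hy⟩ = ⟨Ψ t y, hy'⟩ := Subtype.ext (hrepr ⟨y, hy⟩)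
  ext v w
  rw [ContinuousLinearMap.bilinearComp_apply, InitialDataSet.hFun_of_mem _ hy,
    InitialDataSet.hFun_of_mem _ hy']
  -- the fibrewise identity, read in `T_{⟨y,hy⟩} U = E3` (all tangent spaces are `E3`)
  have e2 := InitialDataSet.comap_h_inner K hΦ hΦ' ⟨y, hy⟩ v w
  rw [OpensChart.mfderiv_apply_of_repr hrepr (hd t _) v,
    OpensChart.mfderiv_apply_of_repr hrepr (hd t _) w] at e2
  exact e2.trans (bilin_congr_point K.h.inner hpt _ _)

/-- The components of the second fundamental form of the pulled-back datum in the chart: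
`k(Φ^* K)(y) = k(K)(Ψ t y) ∘ (DΨ_t(y) × DΨ_t(y))` for `y ∈ U`. Bartnik–Isenberg 2004, §2. [folklore] -/
theorem kFun_comap_of_repr {Φ : U → U} {t : ℝ} (hrepr : ∀ y, (Φ y : E3) = Ψ t y)
    (hΦ : ContMDiff (𝓡 3) (𝓡 3) (∞ + 1) Φ) (hΦ' : ∀ u, Injective (mfderiv (𝓡 3) (𝓡 3) Φ u))
    (hd : ∀ t x, DifferentiableAt ℝ (Ψ t) x) {y : E3} (hy : y ∈ (U : Set E3)) :
    (K.comap Φ hΦ hΦ').kFun y =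
      (K.kFun (Ψ t y)).bilinearComp (fderiv ℝ (Ψ t) y) (fderiv ℝ (Ψ t) y) := by
  have hy' : Ψ t y ∈ (U : Set E3) := by
    rw [← hrepr ⟨y, hy⟩]
    exact (Φ ⟨y, hy⟩).2
  have hpt : Φ ⟨y, hy⟩ = ⟨Ψ t y, hy'⟩ := Subtype.ext (hrepr ⟨y, hy⟩)
  ext v w
  rw [ContinuousLinearMap.bilinearComp_apply, InitialDataSet.kFun_of_mem _ hy,
    InitialDataSet.kFun_of_mem _ hy']
  have e2 := InitialDataSet.comap_k K hΦ hΦ' ⟨y, hy⟩ v w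
  rw [OpensChart.mfderiv_apply_of_repr hrepr (hd t _) v,
    OpensChart.mfderiv_apply_of_repr hrepr (hd t _) w] at e2
  exact e2.trans (bilin_congr_point K.k hpt _ _)

/-- Off `S`, the metric components of the pulled-back datum are those of the datum (`Φ = id` off
`K₀ = S ∩ U`; off `U` both are the junk value). [folklore] -/
theorem hFun_comap_eq_of_notMem {Φ : U → U} {t : ℝ} (hrepr : ∀ y, (Φ y : E3) = Ψ t y)
    (hΦ : ContMDiff (𝓡 3) (𝓡 3) (∞ + 1) Φ) (hΦ' : ∀ u, Injective (mfderiv (𝓡 3) (𝓡 3) Φ u))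
    (hS : IsCompact S) (hSU : S ⊆ (U : Set E3)) (hfix : ∀ t x, x ∉ S → Ψ t x = x) {y : E3}
    (hy : y ∉ S) : (K.comap Φ hΦ hΦ').hFun y = K.hFun y := by
  by_cases hyU : y ∈ (U : Set E3)
  · rw [InitialDataSet.hFun_of_mem _ hyU, InitialDataSet.hFun_of_mem _ hyU]
    exact comap_h_inner_eq_of_notMem K Φ hΦ hΦ' (isCompact_preimage_val hS hSU)
      (fun y hy ↦ fix_of_repr hrepr hfix y hy) hy
  · rw [InitialDataSet.hFun_of_not_mem _ hyU, InitialDataSet.hFun_of_not_mem _ hyU]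

/-- Off `S`, the `k`-components of the pulled-back datum are those of the datum. [folklore] -/
theorem kFun_comap_eq_of_notMem {Φ : U → U} {t : ℝ} (hrepr : ∀ y, (Φ y : E3) = Ψ t y)
    (hΦ : ContMDiff (𝓡 3) (𝓡 3) (∞ + 1) Φ) (hΦ' : ∀ u, Injective (mfderiv (𝓡 3) (𝓡 3) Φ u))
    (hS : IsCompact S) (hSU : S ⊆ (U : Set E3)) (hfix : ∀ t x, x ∉ S → Ψ t x = x) {y : E3}
    (hy : y ∉ S) : (K.comap Φ hΦ hΦ').kFun y = K.kFun y := by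
  by_cases hyU : y ∈ (U : Set E3)
  · rw [InitialDataSet.kFun_of_mem _ hyU, InitialDataSet.kFun_of_mem _ hyU]
    exact comap_k_eq_of_notMem K Φ hΦ hΦ' (isCompact_preimage_val hS hSU)
      (fun y hy ↦ fix_of_repr hrepr hfix y hy) hy
  · rw [InitialDataSet.kFun_of_not_mem _ hyU, InitialDataSet.kFun_of_not_mem _ hyU]

variable (Φ : ℝ → U → U) (hrepr : ∀ t y, (Φ t y : E3) = Ψ t y)
  (hΦ : ∀ t, ContMDiff (𝓡 3) (𝓡 3) (∞ + 1) (Φ t))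
  (hΦ' : ∀ t u, Injective (mfderiv (𝓡 3) (𝓡 3) (Φ t) u))

include hrepr in
/-- **At `t = 0` the pulled-back datum is the datum** (`Ψ 0 = id`, `d(id) = id`). [folklore] -/
theorem comap_family_zero (h0 : ∀ x, Ψ 0 x = x) : K.comap (Φ 0) (hΦ 0) (hΦ' 0) = K :=
  K.comap_eq_self_of_eq_id (hΦ 0) (hΦ' 0) (funext fun y ↦ Subtype.ext ((hrepr 0 y).trans (h0 y)))

/-- A smooth function of `(t, y)`: `h(K)(Ψ t y) ∘ (DΨ_t(y) × DΨ_t(y)) - h(K)(y)` at points with `y ∈ U`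
(where the components `h(K)` are smooth, `InitialDataSet.contDiffAt_hFun`). [folklore] -/
theorem contDiffAt_comap_formula (hΨ : ContDiff ℝ ∞ (uncurry Ψ)) {G : E3 → E3 →L[ℝ] E3 →L[ℝ] ℝ}
    (hG : ∀ y ∈ (U : Set E3), ContDiffAt ℝ ∞ G y)
    (hmem : ∀ t x, Ψ t x ∈ (U : Set E3) ↔ x ∈ (U : Set E3)) (p : ℝ × E3) (hp : p.2 ∈ (U : Set E3)) :
    ContDiffAt ℝ ∞ (fun q : ℝ × E3 ↦
      (G (Ψ q.1 q.2)).bilinearComp (fderiv ℝ (Ψ q.1) q.2) (fderiv ℝ (Ψ q.1) q.2) - G q.2) p := by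
  have hA : ContDiff ℝ ∞ fun q : ℝ × E3 ↦ fderiv ℝ (Ψ q.1) q.2 := by
    have h2 : ContDiff ℝ ∞ (uncurry fun (q : ℝ × E3) (y : E3) ↦ Ψ q.1 y) :=
      hΨ.comp (contDiff_fst.fst.prodMk contDiff_snd)
    exact h2.fderiv (contDiff_snd (n := ∞)) (le_of_eq (by rfl))
  have hB : ContDiffAt ℝ ∞ (fun q : ℝ × E3 ↦ G (Ψ q.1 q.2)) p :=
    (hG _ ((hmem p.1 p.2).2 hp)).comp p hΨ.contDiffAt
  have hBA : ContDiffAt ℝ ∞ (fun q : ℝ × E3 ↦ (G (Ψ q.1 q.2), fderiv ℝ (Ψ q.1) q.2)) p :=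
    hB.prodMk hA.contDiffAt
  exact (contDiff_bilinearCompSelf.contDiffAt.comp p hBA).sub ((hG _ hp).comp p contDiffAt_snd)

include hrepr in
/-- **The metric component differences `h(Φ_t^* K) - h(K)` of a gauge family are jointly smooth on
`ℝ × ℝ³`**: on `ℝ × U` they are given by the smooth formula of `hFun_comap_of_repr`, and on `ℝ × Sᶜ`
they vanish (`Φ t = id` near such points). [folklore] -/
theorem contDiff_hFun_family (hΨ : ContDiff ℝ ∞ (uncurry Ψ)) (hinv : ∀ t x, Ψ (-t) (Ψ t x) = x)
    (hS : IsCompact S) (hSU : S ⊆ (U : Set E3)) (hfix : ∀ t x, x ∉ S → Ψ t x = x) :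
    ContDiff ℝ ∞ (uncurry fun t y ↦ (K.comap (Φ t) (hΦ t) (hΦ' t)).hFun y - K.hFun y) := by
  have hd : ∀ t x, DifferentiableAt ℝ (Ψ t) x := fun t x ↦
    (hΨ.comp (contDiff_prodMk_right t)).differentiable (by simp) x
  have hmem := family_mem_iff (U := U) hinv hfix hSU
  refine contDiff_iff_contDiffAt.2 fun p ↦ ?_
  by_cases hp : p.2 ∈ (U : Set E3)
  · -- on the open set `ℝ × U` the difference is the smooth formula
    have hev : (uncurry fun t y ↦ (K.comap (Φ t) (hΦ t) (hΦ' t)).hFun y - K.hFun y) =ᶠ[𝓝 p]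
        fun q : ℝ × E3 ↦ (K.hFun (Ψ q.1 q.2)).bilinearComp (fderiv ℝ (Ψ q.1) q.2)
          (fderiv ℝ (Ψ q.1) q.2) - K.hFun q.2 := by
      have ho : IsOpen {q : ℝ × E3 | q.2 ∈ (U : Set E3)} := U.isOpen.preimage continuous_snd
      filter_upwards [ho.mem_nhds hp] with q hq
      simp only [uncurry]
      rw [hFun_comap_of_repr K (hrepr q.1) (hΦ q.1) (hΦ' q.1) hd hq]
    exact (contDiffAt_comap_formula hΨ (fun y hy ↦ K.contDiffAt_hFun ⟨y, hy⟩) hmem p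
      hp).congr_of_eventuallyEq hev
  · -- off `S` (hence near `p`, as `S ⊆ U` is closed) the difference vanishes
    have hpS : p.2 ∉ S := fun h ↦ hp (hSU h)
    have hev : (uncurry fun t y ↦ (K.comap (Φ t) (hΦ t) (hΦ' t)).hFun y - K.hFun y) =ᶠ[𝓝 p]
        fun _ ↦ 0 := by
      have ho : IsOpen {q : ℝ × E3 | q.2 ∉ S} := hS.isClosed.isOpen_compl.preimage continuous_snd
      filter_upwards [ho.mem_nhds hpS] with q hq
      simp only [uncurry]
      rw [hFun_comap_eq_of_notMem K (hrepr q.1) (hΦ q.1) (hΦ' q.1) hS hSU hfix hq]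
      exact sub_self (K.hFun q.2)
    exact (contDiffAt_const (c := (0 : E3 →L[ℝ] E3 →L[ℝ] ℝ))).congr_of_eventuallyEq hev

include hrepr in
/-- **The second-fundamental-form component differences `k(Φ_t^* K) - k(K)` are jointly smooth on
`ℝ × ℝ³`** (same proof with `kFun`). [folklore] -/
theorem contDiff_kFun_family (hΨ : ContDiff ℝ ∞ (uncurry Ψ)) (hinv : ∀ t x, Ψ (-t) (Ψ t x) = x)
    (hS : IsCompact S) (hSU : S ⊆ (U : Set E3)) (hfix : ∀ t x, x ∉ S → Ψ t x = x) :
    ContDiff ℝ ∞ (uncurry fun t y ↦ (K.comap (Φ t) (hΦ t) (hΦ' t)).kFun y - K.kFun y) := by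
  have hd : ∀ t x, DifferentiableAt ℝ (Ψ t) x := fun t x ↦
    (hΨ.comp (contDiff_prodMk_right t)).differentiable (by simp) x
  have hmem := family_mem_iff (U := U) hinv hfix hSU
  refine contDiff_iff_contDiffAt.2 fun p ↦ ?_
  by_cases hp : p.2 ∈ (U : Set E3)
  · have hev : (uncurry fun t y ↦ (K.comap (Φ t) (hΦ t) (hΦ' t)).kFun y - K.kFun y) =ᶠ[𝓝 p]
        fun q : ℝ × E3 ↦ (K.kFun (Ψ q.1 q.2)).bilinearComp (fderiv ℝ (Ψ q.1) q.2)
          (fderiv ℝ (Ψ q.1) q.2) - K.kFun q.2 := by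
      have ho : IsOpen {q : ℝ × E3 | q.2 ∈ (U : Set E3)} := U.isOpen.preimage continuous_snd
      filter_upwards [ho.mem_nhds hp] with q hq
      simp only [uncurry]
      rw [kFun_comap_of_repr K (hrepr q.1) (hΦ q.1) (hΦ' q.1) hd hq]
    exact (contDiffAt_comap_formula hΨ (fun y hy ↦ K.contDiffAt_kFun ⟨y, hy⟩) hmem p
      hp).congr_of_eventuallyEq hev
  · have hpS : p.2 ∉ S := fun h ↦ hp (hSU h)
    have hev : (uncurry fun t y ↦ (K.comap (Φ t) (hΦ t) (hΦ' t)).kFun y - K.kFun y) =ᶠ[𝓝 p]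
        fun _ ↦ 0 := by
      have ho : IsOpen {q : ℝ × E3 | q.2 ∉ S} := hS.isClosed.isOpen_compl.preimage continuous_snd
      filter_upwards [ho.mem_nhds hpS] with q hq
      simp only [uncurry]
      rw [kFun_comap_eq_of_notMem K (hrepr q.1) (hΦ q.1) (hΦ' q.1) hS hSU hfix hq]
      exact sub_self (K.kFun q.2)
    exact (contDiffAt_const (c := (0 : E3 →L[ℝ] E3 →L[ℝ] ℝ))).congr_of_eventuallyEq hev

include hrepr in
/-- The component differences of a gauge family are supported in `S`. [folklore] -/
theorem support_hFun_family_subset (hS : IsCompact S) (hSU : S ⊆ (U : Set E3))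
    (hfix : ∀ t x, x ∉ S → Ψ t x = x) (t : ℝ) :
    support ((K.comap (Φ t) (hΦ t) (hΦ' t)).hFun - K.hFun) ⊆ S := by
  intro y hy
  by_contra hyS
  refine hy ?_
  rw [Pi.sub_apply, hFun_comap_eq_of_notMem K (hrepr t) (hΦ t) (hΦ' t) hS hSU hfix hyS]
  exact sub_self (K.hFun y)

include hrepr in
/-- The `k`-component differences of a gauge family are supported in `S`. [folklore] -/
theorem support_kFun_family_subset (hS : IsCompact S) (hSU : S ⊆ (U : Set E3))
    (hfix : ∀ t x, x ∉ S → Ψ t x = x) (t : ℝ) :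
    support ((K.comap (Φ t) (hΦ t) (hΦ' t)).kFun - K.kFun) ⊆ S := by
  intro y hy
  by_contra hyS
  refine hy ?_
  rw [Pi.sub_apply, kFun_comap_eq_of_notMem K (hrepr t) (hΦ t) (hΦ' t) hS hSU hfix hyS]
  exact sub_self (K.kFun y)

end Components

/-! ## §3 Non-triviality: a shear in the differential changes every Riemannian datum -/

section Shear

variable {U : Opens E3}

/-- **A gauge transformation whose differential at a fixed point is a non-trivial shear changes every
datum**: if `Φ u = u`, `dΦ_u v = v + c w`, `dΦ_u w = w` with `w ≠ 0`, `c ≠ 0`, then `Φ^* K ≠ K`, because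
`(Φ^* h)_u(v, w) - h_u(v, w) = c · h_u(w, w) ≠ 0` by positive-definiteness of `h`. O'Neill 1983, Ch. 3
(pull-back metrics). [folklore] -/
theorem comap_ne_of_shear (K : InitialDataSet 𝓘(ℝ, E3) U) (Φ : U → U)
    (hΦ : ContMDiff (𝓡 3) (𝓡 3) (∞ + 1) Φ) (hΦ' : ∀ u, Injective (mfderiv (𝓡 3) (𝓡 3) Φ u))
    {Ψt : E3 → E3} (hrepr : ∀ y, (Φ y : E3) = Ψt y) {u : U} (hdu : DifferentiableAt ℝ Ψt u)
    (hu : Φ u = u) {v w : E3} {c : ℝ} (hv : fderiv ℝ Ψt u v = v + c • w)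
    (hw : fderiv ℝ Ψt u w = w) (hw0 : w ≠ 0) (hc : c ≠ 0) : K.comap Φ hΦ hΦ' ≠ K := by
  intro heq
  have h1 : (K.comap Φ hΦ hΦ').h.inner u v w = K.h.inner u v w := by rw [heq]
  rw [InitialDataSet.comap_h_inner, OpensChart.mfderiv_apply_of_repr hrepr hdu v,
    OpensChart.mfderiv_apply_of_repr hrepr hdu w, hv, hw,
    bilin_congr_point K.h.inner hu (v + c • w) w] at h1
  -- read the identity in the chart components `hFun K u : E3 →L E3 →L ℝ` (plain linear algebra)
  have h1' : K.hFun u (v + c • w) w = K.hFun u v w := by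
    rw [InitialDataSet.hFun_of_mem K u.2]
    exact h1
  have hpos : 0 < K.hFun u w w := by
    rw [InitialDataSet.hFun_of_mem K u.2]
    exact K.h.pos u w hw0
  simp only [map_add, map_smul, FunLike.coe_add, FunLike.coe_smul, Pi.add_apply, Pi.smul_apply,
    smul_eq_mul] at h1'
  have h2 : c * K.hFun u w w = 0 := by linarith
  rcases mul_eq_zero.1 h2 with h | h
  · exact hc h
  · exact hpos.ne' h

end Shear


/-- Registered stub `stub_gaugeFamily_shear` of the crux item (verbatim signature): the statement of
`comap_ne_of_shear` with all binders explicit. [folklore] -/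
theorem stub_gaugeFamily_shear : ∀ (U : TopologicalSpace.Opens E3) (K : InitialDataSet 𝓘(ℝ, E3) U) (Φ : U → U) (hΦ : ContMDiff (𝓡 3) (𝓡 3) (∞ + 1) Φ) (hΦ' : ∀ u, Function.Injective (mfderiv (𝓡 3) (𝓡 3) Φ u)) (Ψt : E3 → E3), (∀ y, (Φ y : E3) = Ψt y) → ∀ (u : U), DifferentiableAt ℝ Ψt u → Φ u = u → ∀ (v w : E3) (c : ℝ), fderiv ℝ Ψt u v = v + c • w → fderiv ℝ Ψt u w = w → w ≠ 0 → c ≠ 0 → K.comap Φ hΦ hΦ' ≠ K :=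
  fun _ K Φ hΦ hΦ' _ hrepr _ hdu hu _ _ _ hv hw hw0 hc ↦
    comap_ne_of_shear K Φ hΦ hΦ' hrepr hdu hu hv hw hw0 hc

end Summit.FinalStateConjecture.FinalStateConjecture.Theorems.BulkKerrCaptureC2.Centre
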